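import Mathlib
import Summits.QuantumFields.YangMills.Theorems.TransverseWardBLSectorChart
import Summits.QuantumFields.YangMills.Theorems.TransverseWardBLSectorMeanZero
import Summits.QuantumFields.YangMills.Theorems.TransverseWardBLSectorPoincare
import HarnessLib

/-!
# Transfer along the sector chart: null faces, real chart identity, zero mean on each sector polytope

Route-independent helper for the crux stmt-QuantumFields-23103 `Theses.TransverseWardBL.ConvexPhaseCoexactBound`
(route `TransverseWardBL`, LINE g9-C of the ideator seat ym-idea-4; abelian `U(1)` line onto the leaf
`Theorems.U1HelicityGapTorusD4` — nothing here bears on the Yang–Mills mass gap).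

For a flux sector `k` with closed polytope `P_k = {v ∈ V | ∀ p, |v_p + c_{k,p}| ≤ 1}` (`c_k = 2πn_k`):
* `volume_coord_levelSet_eq_zero`, `sectorBox_ae_eq_open` — the faces of `P_k` are `vol_V`-null, so closed
  and open boxes carry the same integrals;
* `sector_integral_eq` — the real form of the sector chart identity
  `∫ 1_{G_k} g(ω(U)) dHaar = c · ∫_{P_k} g(v + c_k) dvol` for bounded measurable `g ≥ 0`;
* `sector_mean_zero` — `∫_{P_k} f̃(v + c_k) w̃(v + c_k) dvol = 0` for the transverse functional
  `f̃ = Σ u_p sin`, `w̃ = e^{βΣcos}` (transfer of `integral_sector_testForm_eq_zero`).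
The per-sector estimate and the sum over sectors are in `TransverseWardBLConvexPhaseCoexactBound`.
-/

noncomputable section

open scoped BigOperators ENNReal
open MeasureTheory Finset Set
open Literature.MathematicalPhysics.QuantumLattice Literature.MathematicalPhysics.QuantumFieldTheory
open Summit.QuantumFields.YangMills.Theorems.SelfNormalisedSkewness.Negative

namespace Summit.QuantumFields.YangMills.Theorems.TransverseWardBL

variable {S : ℕ} [NeZero S]

/-! ### Faces of the sector boxes are null -/

/-- A non-zero level set of a coordinate on the subspace `V` is `vol_V`-null (empty, or a translate of a
proper linear subspace). [folklore] -/
theorem volume_coord_levelSet_eq_zero (p : Plaquette 4 S) {t : ℝ} (ht : t ≠ 0) :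
    volume {v : LinearMap.range (plaqCoboundary S) | (v : EuclideanSpace ℝ (Plaquette 4 S)) p = t} = 0 := by
  classical
  set V := LinearMap.range (plaqCoboundary S)
  set ℓ : V →ₗ[ℝ] ℝ := (EuclideanSpace.proj p : EuclideanSpace ℝ (Plaquette 4 S) →L[ℝ] ℝ).toLinearMap ∘ₗ
    V.subtype with hℓ
  have hℓv : ∀ v : V, ℓ v = (v : EuclideanSpace ℝ (Plaquette 4 S)) p := fun v => by
    simp [hℓ]
  by_cases hex : ∃ v₀ : V, (v₀ : EuclideanSpace ℝ (Plaquette 4 S)) p = t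
  · obtain ⟨v₀, hv₀⟩ := hex
    have hker : LinearMap.ker ℓ ≠ ⊤ := by
      intro htop
      have : v₀ ∈ LinearMap.ker ℓ := by rw [htop]; exact Submodule.mem_top
      rw [LinearMap.mem_ker, hℓv] at this
      exact ht (hv₀ ▸ this.symm ▸ rfl)
    have hset : {v : V | (v : EuclideanSpace ℝ (Plaquette 4 S)) p = t} =
        (fun v : V => -v₀ + v) ⁻¹' (LinearMap.ker ℓ : Set V) := by
      ext v
      simp only [Set.mem_setOf_eq, Set.mem_preimage, SetLike.mem_coe, LinearMap.mem_ker, hℓv,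
        Submodule.coe_add, Submodule.coe_neg, PiLp.add_apply, PiLp.neg_apply, hv₀]
      constructor
      · intro h; rw [h]; ring
      · intro h; linarith
    rw [hset, measure_preimage_add]
    exact Measure.addHaar_submodule volume _ hker
  · have : {v : V | (v : EuclideanSpace ℝ (Plaquette 4 S)) p = t} = ∅ := by
      ext v
      simp only [Set.mem_setOf_eq, Set.mem_empty_iff_false, iff_false]
      exact fun h => hex ⟨v, h⟩
    rw [this, measure_empty]

/-- `2πn ± 1 ≠ 0`-type fact: `|2πn| ≠ 1` for an integer `n`, so `±1 − 2πn ≠ 0`. [folklore] -/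
theorem one_sub_two_pi_mul_int_ne_zero (n : ℤ) (σ : ℝ) (hσ : σ = 1 ∨ σ = -1) :
    σ - 2 * Real.pi * n ≠ 0 := by
  intro h
  have hπ := Real.pi_gt_three
  rcases eq_or_ne n 0 with hn | hn
  · subst hn; rcases hσ with h1 | h1 <;> subst h1 <;> simp at h
  · have h1 : (1 : ℝ) ≤ |(n : ℝ)| := by exact_mod_cast Int.one_le_abs hn
    have h2 : |σ| = 1 := by rcases hσ with h3 | h3 <;> subst h3 <;> simp
    have h3 : σ = 2 * Real.pi * n := by linarith
    have : |σ| = 2 * Real.pi * |(n : ℝ)| := by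
      rw [h3, abs_mul, abs_of_pos (by positivity)]
    nlinarith

/-- **Closed and open sector boxes agree almost everywhere** (for centres in `(2πℤ)^P`). [folklore] -/
theorem sectorBox_ae_eq_open (n : Plaquette 4 S → ℤ) :
    {v : LinearMap.range (plaqCoboundary S) | ∀ p : Plaquette 4 S,
        |(v : EuclideanSpace ℝ (Plaquette 4 S)) p + 2 * Real.pi * (n p : ℝ)| < 1} =ᵐ[volume]
      {v : LinearMap.range (plaqCoboundary S) | ∀ p : Plaquette 4 S,
        |(v : EuclideanSpace ℝ (Plaquette 4 S)) p + 2 * Real.pi * (n p : ℝ)| ≤ 1} := by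
  refine ae_eq_set.2 ⟨?_, ?_⟩
  · exact measure_mono_null (fun v hv => (hv.2 fun p => (hv.1 p).le).elim) measure_empty
  · have hsub : {v : LinearMap.range (plaqCoboundary S) | ∀ p : Plaquette 4 S,
        |(v : EuclideanSpace ℝ (Plaquette 4 S)) p + 2 * Real.pi * (n p : ℝ)| ≤ 1} \
        {v : LinearMap.range (plaqCoboundary S) | ∀ p : Plaquette 4 S,
          |(v : EuclideanSpace ℝ (Plaquette 4 S)) p + 2 * Real.pi * (n p : ℝ)| < 1} ⊆
        ⋃ p : Plaquette 4 S, ({v : LinearMap.range (plaqCoboundary S) |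
            (v : EuclideanSpace ℝ (Plaquette 4 S)) p = 1 - 2 * Real.pi * (n p : ℝ)} ∪
          {v : LinearMap.range (plaqCoboundary S) |
            (v : EuclideanSpace ℝ (Plaquette 4 S)) p = -1 - 2 * Real.pi * (n p : ℝ)}) := by
      intro v hv
      obtain ⟨h1, h2⟩ := hv
      simp only [Set.mem_setOf_eq, not_forall, not_lt] at h1 h2
      obtain ⟨p, hp⟩ := h2
      have heq : |(v : EuclideanSpace ℝ (Plaquette 4 S)) p + 2 * Real.pi * (n p : ℝ)| = 1 :=
        le_antisymm (h1 p) hp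
      refine Set.mem_iUnion.2 ⟨p, ?_⟩
      rcases abs_eq (zero_le_one) |>.1 heq with h | h
      · left; simp only [Set.mem_setOf_eq]; linarith
      · right; simp only [Set.mem_setOf_eq]; linarith
    refine measure_mono_null hsub (measure_iUnion_null fun p => measure_union_null ?_ ?_)
    · exact volume_coord_levelSet_eq_zero p (one_sub_two_pi_mul_int_ne_zero (n p) 1 (Or.inl rfl))
    · exact volume_coord_levelSet_eq_zero p (one_sub_two_pi_mul_int_ne_zero (n p) (-1) (Or.inr rfl))

/-! ### Bounded boxes -/

/-- The closed sector box is bounded, hence of finite volume. [folklore] -/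
theorem volume_sectorBox_lt_top (c : Plaquette 4 S → ℝ) :
    volume {v : LinearMap.range (plaqCoboundary S) | ∀ p : Plaquette 4 S,
      |(v : EuclideanSpace ℝ (Plaquette 4 S)) p + c p| ≤ 1} < ⊤ := by
  refine Bornology.IsBounded.measure_lt_top ?_
  refine (Metric.isBounded_closedBall (x := (0 : LinearMap.range (plaqCoboundary S)))
    (r := Real.sqrt (∑ p : Plaquette 4 S, (|c p| + 1) ^ 2))).subset fun v hv => ?_
  rw [Metric.mem_closedBall, dist_zero_right]
  have hn : ‖v‖ = ‖(v : EuclideanSpace ℝ (Plaquette 4 S))‖ := (Submodule.coe_norm v).symm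
  rw [hn, ← sqrt_sum_sq_eq_norm]
  refine Real.sqrt_le_sqrt (Finset.sum_le_sum fun p _ => ?_)
  have h1 : |(v : EuclideanSpace ℝ (Plaquette 4 S)) p| ≤ |c p| + 1 := by
    have := hv p
    have h2 : |(v : EuclideanSpace ℝ (Plaquette 4 S)) p| ≤
        |(v : EuclideanSpace ℝ (Plaquette 4 S)) p + c p| + |c p| := by
      calc |(v : EuclideanSpace ℝ (Plaquette 4 S)) p|
          = |((v : EuclideanSpace ℝ (Plaquette 4 S)) p + c p) + (-c p)| := by ring_nf
        _ ≤ |(v : EuclideanSpace ℝ (Plaquette 4 S)) p + c p| + |-c p| := abs_add_le _ _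
        _ = _ := by rw [abs_neg]
    linarith
  calc (v : EuclideanSpace ℝ (Plaquette 4 S)) p ^ 2 = |(v : EuclideanSpace ℝ (Plaquette 4 S)) p| ^ 2 :=
        (sq_abs _).symm
    _ ≤ (|c p| + 1) ^ 2 := pow_le_pow_left₀ (abs_nonneg _) h1 2

/-! ### The real form of the sector chart identity -/

/-- **Sector chart identity, real form**: for a measurable `g : ℝ^P → ℝ` with `0 ≤ g ≤ B`, with the chart
constant `c` of `exists_sectorChart_constant`,
`∫ 1_{G_k}(U) g(ω(U)) dHaar^E = c.toReal · ∫_{P_k} g(v + c_k) dvol_V`. [folklore] -/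
theorem sector_integral_eq {c : ℝ≥0∞}
    (hc : ∀ (k : {q : Fin 4 × Fin 4 // q.1 < q.2} → ℤ)
      (g : EuclideanSpace ℝ (Plaquette 4 S) → ℝ≥0∞), Measurable g →
      ∫⁻ U, {U : GaugeConfig 4 S Circle | (∀ p : Plaquette 4 S, |plaqAngle U p| ≤ 1) ∧
          ∀ o : {q : Fin 4 × Fin 4 // q.1 < q.2}, magneticFlux U 0 o.1.1 o.1.2 = 2 * Real.pi * k o}.indicator
          (fun U => g (plaqAngle U)) U ∂(Measure.pi fun _ : Edge 4 S => haarProbability Circle) =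
        c * ∫⁻ v : LinearMap.range (plaqCoboundary S),
          {v : LinearMap.range (plaqCoboundary S) | ∀ p : Plaquette 4 S,
            |(v : EuclideanSpace ℝ (Plaquette 4 S)) p +
              2 * Real.pi * ((if p.1 p.2.1.1 = 0 ∧ p.1 p.2.1.2 = 0 then k p.2 else 0 : ℤ) : ℝ)| ≤ 1}.indicator
            (fun v => g ((v : EuclideanSpace ℝ (Plaquette 4 S)) + WithLp.toLp 2 (fun p : Plaquette 4 S =>
              2 * Real.pi * ((if p.1 p.2.1.1 = 0 ∧ p.1 p.2.1.2 = 0 then k p.2 else 0 : ℤ) : ℝ)))) v)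
    (k : {q : Fin 4 × Fin 4 // q.1 < q.2} → ℤ) {g : EuclideanSpace ℝ (Plaquette 4 S) → ℝ} (hg : Measurable g)
    {B : ℝ} (hg0 : ∀ z, 0 ≤ g z) (hgB : ∀ z, g z ≤ B) :
    ∫ U, {U : GaugeConfig 4 S Circle | (∀ p : Plaquette 4 S, |plaqAngle U p| ≤ 1) ∧
        ∀ o : {q : Fin 4 × Fin 4 // q.1 < q.2}, magneticFlux U 0 o.1.1 o.1.2 = 2 * Real.pi * k o}.indicator
        (fun U => g (plaqAngle U)) U ∂(Measure.pi fun _ : Edge 4 S => haarProbability Circle) =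
      c.toReal * ∫ v in {v : LinearMap.range (plaqCoboundary S) | ∀ p : Plaquette 4 S,
          |(v : EuclideanSpace ℝ (Plaquette 4 S)) p +
            2 * Real.pi * ((if p.1 p.2.1.1 = 0 ∧ p.1 p.2.1.2 = 0 then k p.2 else 0 : ℤ) : ℝ)| ≤ 1},
        g ((v : EuclideanSpace ℝ (Plaquette 4 S)) + WithLp.toLp 2 (fun p : Plaquette 4 S =>
          2 * Real.pi * ((if p.1 p.2.1.1 = 0 ∧ p.1 p.2.1.2 = 0 then k p.2 else 0 : ℤ) : ℝ))) := by
  classical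
  set μH : Measure (GaugeConfig 4 S Circle) := Measure.pi fun _ : Edge 4 S => haarProbability Circle with hμH
  set Gk : Set (GaugeConfig 4 S Circle) := {U | (∀ p : Plaquette 4 S, |plaqAngle U p| ≤ 1) ∧
      ∀ o : {q : Fin 4 × Fin 4 // q.1 < q.2}, magneticFlux U 0 o.1.1 o.1.2 = 2 * Real.pi * k o} with hGk
  set cv : EuclideanSpace ℝ (Plaquette 4 S) := WithLp.toLp 2 (fun p : Plaquette 4 S =>
    2 * Real.pi * ((if p.1 p.2.1.1 = 0 ∧ p.1 p.2.1.2 = 0 then k p.2 else 0 : ℤ) : ℝ)) with hcv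
  set Pk : Set (LinearMap.range (plaqCoboundary S)) := {v | ∀ p : Plaquette 4 S,
    |(v : EuclideanSpace ℝ (Plaquette 4 S)) p +
      2 * Real.pi * ((if p.1 p.2.1.1 = 0 ∧ p.1 p.2.1.2 = 0 then k p.2 else 0 : ℤ) : ℝ)| ≤ 1} with hPk
  have hB0 : 0 ≤ B := (hg0 0).trans (hgB 0)
  have hGm : MeasurableSet Gk := measurableSet_sector k
  have hPm : MeasurableSet Pk := measurableSet_sectorBox _
  have key := hc k (fun z => ENNReal.ofReal (g z)) (ENNReal.measurable_ofReal.comp hg)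
  -- upstairs: a bounded measurable function on a probability space
  have hmeasU : Measurable fun U : GaugeConfig 4 S Circle => g (plaqAngle U) := hg.comp measurable_plaqAngle
  have hintU : Integrable (Gk.indicator fun U => g (plaqAngle U)) μH := by
    refine Integrable.of_bound ((hmeasU.indicator hGm).aestronglyMeasurable) B (ae_of_all _ fun U => ?_)
    rw [Real.norm_eq_abs]
    by_cases hU : U ∈ Gk
    · rw [Set.indicator_of_mem hU, abs_of_nonneg (hg0 _)]; exact hgB _
    · rw [Set.indicator_of_notMem hU, abs_zero]; exact hB0
  have hnnU : 0 ≤ᵐ[μH] Gk.indicator fun U => g (plaqAngle U) :=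
    ae_of_all _ fun U => Set.indicator_nonneg (fun _ _ => hg0 _) U
  have hL : ∫⁻ U, Gk.indicator (fun U => ENNReal.ofReal (g (plaqAngle U))) U ∂μH =
      ENNReal.ofReal (∫ U, Gk.indicator (fun U => g (plaqAngle U)) U ∂μH) := by
    rw [ofReal_integral_eq_lintegral_ofReal hintU hnnU]
    refine lintegral_congr fun U => ?_
    by_cases hU : U ∈ Gk
    · rw [Set.indicator_of_mem hU, Set.indicator_of_mem hU]
    · rw [Set.indicator_of_notMem hU, Set.indicator_of_notMem hU, ENNReal.ofReal_zero]
  -- downstairs: a bounded measurable function on a set of finite volume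
  have hmeasV : Measurable fun v : LinearMap.range (plaqCoboundary S) =>
      g ((v : EuclideanSpace ℝ (Plaquette 4 S)) + cv) :=
    hg.comp (continuous_subtype_val.add continuous_const).measurable
  have hintV : IntegrableOn (fun v : LinearMap.range (plaqCoboundary S) =>
      g ((v : EuclideanSpace ℝ (Plaquette 4 S)) + cv)) Pk volume :=
    Measure.integrableOn_of_bounded (M := B) (volume_sectorBox_lt_top _).ne hmeasV.aestronglyMeasurable
      (ae_of_all _ fun v => by rw [Real.norm_eq_abs, abs_of_nonneg (hg0 _)]; exact hgB _)
  have hR : ∫⁻ v, Pk.indicator (fun v => ENNReal.ofReal (g ((v : EuclideanSpace ℝ (Plaquette 4 S)) + cv))) v =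
      ENNReal.ofReal (∫ v in Pk, g ((v : EuclideanSpace ℝ (Plaquette 4 S)) + cv)) := by
    rw [lintegral_indicator hPm, ofReal_integral_eq_lintegral_ofReal hintV (ae_of_all _ fun v => hg0 _)]
  have key' : ENNReal.ofReal (∫ U, Gk.indicator (fun U => g (plaqAngle U)) U ∂μH) =
      c * ENNReal.ofReal (∫ v in Pk, g ((v : EuclideanSpace ℝ (Plaquette 4 S)) + cv)) := by
    rw [← hL, ← hR]
    exact key
  have := congrArg ENNReal.toReal key'
  rw [ENNReal.toReal_ofReal (integral_nonneg fun U => Set.indicator_nonneg (fun _ _ => hg0 _) U),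
    ENNReal.toReal_mul, ENNReal.toReal_ofReal (setIntegral_nonneg hPm fun v _ => hg0 _)] at this
  exact this

/-! ### Zero mean and the per-sector estimate -/

/-- Bound for the Wilson-type weight `exp(β Σ cos z_q) ≤ exp(|β| |P|)`. [folklore] -/
theorem exp_mul_sum_cos_le (β : ℝ) (z : EuclideanSpace ℝ (Plaquette 4 S)) :
    Real.exp (β * ∑ q : Plaquette 4 S, Real.cos (z q)) ≤ Real.exp (|β| * Fintype.card (Plaquette 4 S)) := by
  refine Real.exp_le_exp.2 ?_
  calc β * ∑ q : Plaquette 4 S, Real.cos (z q) ≤ |β * ∑ q : Plaquette 4 S, Real.cos (z q)| := le_abs_self _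
    _ = |β| * |∑ q : Plaquette 4 S, Real.cos (z q)| := abs_mul _ _
    _ ≤ |β| * Fintype.card (Plaquette 4 S) := by
        refine mul_le_mul_of_nonneg_left ?_ (abs_nonneg β)
        calc |∑ q : Plaquette 4 S, Real.cos (z q)| ≤ ∑ q : Plaquette 4 S, |Real.cos (z q)| :=
              Finset.abs_sum_le_sum_abs _ _
          _ ≤ ∑ _q : Plaquette 4 S, (1 : ℝ) := Finset.sum_le_sum fun q _ => Real.abs_cos_le_one _
          _ = Fintype.card (Plaquette 4 S) := by simp

/-- Bound for the test functional `|Σ u_p sin z_p| ≤ Σ |u_p|`. [folklore] -/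
theorem abs_sum_mul_sin_le (u : Plaquette 4 S → ℝ) (z : EuclideanSpace ℝ (Plaquette 4 S)) :
    |∑ p : Plaquette 4 S, u p * Real.sin (z p)| ≤ ∑ p : Plaquette 4 S, |u p| := by
  refine (Finset.abs_sum_le_sum_abs _ _).trans (Finset.sum_le_sum fun p _ => ?_)
  rw [abs_mul]
  calc |u p| * |Real.sin (z p)| ≤ |u p| * 1 := mul_le_mul_of_nonneg_left (Real.abs_sin_le_one _) (abs_nonneg _)
    _ = |u p| := mul_one _

/-- **Zero mean of the transverse functional on each sector polytope** (transfer of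
`integral_sector_testForm_eq_zero` through the sector chart). [folklore] -/
theorem sector_mean_zero {c : ℝ≥0∞} (hc0 : c ≠ 0) (hct : c ≠ ⊤)
    (hc : ∀ (k : {q : Fin 4 × Fin 4 // q.1 < q.2} → ℤ)
      (g : EuclideanSpace ℝ (Plaquette 4 S) → ℝ≥0∞), Measurable g →
      ∫⁻ U, {U : GaugeConfig 4 S Circle | (∀ p : Plaquette 4 S, |plaqAngle U p| ≤ 1) ∧
          ∀ o : {q : Fin 4 × Fin 4 // q.1 < q.2}, magneticFlux U 0 o.1.1 o.1.2 = 2 * Real.pi * k o}.indicator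
          (fun U => g (plaqAngle U)) U ∂(Measure.pi fun _ : Edge 4 S => haarProbability Circle) =
        c * ∫⁻ v : LinearMap.range (plaqCoboundary S),
          {v : LinearMap.range (plaqCoboundary S) | ∀ p : Plaquette 4 S,
            |(v : EuclideanSpace ℝ (Plaquette 4 S)) p +
              2 * Real.pi * ((if p.1 p.2.1.1 = 0 ∧ p.1 p.2.1.2 = 0 then k p.2 else 0 : ℤ) : ℝ)| ≤ 1}.indicator
            (fun v => g ((v : EuclideanSpace ℝ (Plaquette 4 S)) + WithLp.toLp 2 (fun p : Plaquette 4 S =>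
              2 * Real.pi * ((if p.1 p.2.1.1 = 0 ∧ p.1 p.2.1.2 = 0 then k p.2 else 0 : ℤ) : ℝ)))) v)
    (k : {q : Fin 4 × Fin 4 // q.1 < q.2} → ℤ) (β : ℝ) (u : Plaquette 4 S → ℝ)
    (hu0 : ∀ o : {q : Fin 4 × Fin 4 // q.1 < q.2}, (∑ q : Plaquette 4 S, (if q.2 = o then u q else 0)) = 0) :
    ∫ v in {v : LinearMap.range (plaqCoboundary S) | ∀ p : Plaquette 4 S,
        |(v : EuclideanSpace ℝ (Plaquette 4 S)) p +
          2 * Real.pi * ((if p.1 p.2.1.1 = 0 ∧ p.1 p.2.1.2 = 0 then k p.2 else 0 : ℤ) : ℝ)| ≤ 1},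
      (∑ p : Plaquette 4 S, u p * Real.sin (((v : EuclideanSpace ℝ (Plaquette 4 S)) + WithLp.toLp 2
          (fun p : Plaquette 4 S => 2 * Real.pi * ((if p.1 p.2.1.1 = 0 ∧ p.1 p.2.1.2 = 0 then k p.2 else 0 : ℤ) : ℝ))) p)) *
        Real.exp (β * ∑ q : Plaquette 4 S, Real.cos (((v : EuclideanSpace ℝ (Plaquette 4 S)) + WithLp.toLp 2
          (fun p : Plaquette 4 S => 2 * Real.pi * ((if p.1 p.2.1.1 = 0 ∧ p.1 p.2.1.2 = 0 then k p.2 else 0 : ℤ) : ℝ))) q)) = 0 := by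
  classical
  set μH : Measure (GaugeConfig 4 S Circle) := Measure.pi fun _ : Edge 4 S => haarProbability Circle with hμH
  set Gk : Set (GaugeConfig 4 S Circle) := {U | (∀ p : Plaquette 4 S, |plaqAngle U p| ≤ 1) ∧
      ∀ o : {q : Fin 4 × Fin 4 // q.1 < q.2}, magneticFlux U 0 o.1.1 o.1.2 = 2 * Real.pi * k o} with hGk
  set cv : EuclideanSpace ℝ (Plaquette 4 S) := WithLp.toLp 2 (fun p : Plaquette 4 S =>
    2 * Real.pi * ((if p.1 p.2.1.1 = 0 ∧ p.1 p.2.1.2 = 0 then k p.2 else 0 : ℤ) : ℝ)) with hcv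
  set Pk : Set (LinearMap.range (plaqCoboundary S)) := {v | ∀ p : Plaquette 4 S,
    |(v : EuclideanSpace ℝ (Plaquette 4 S)) p +
      2 * Real.pi * ((if p.1 p.2.1.1 = 0 ∧ p.1 p.2.1.2 = 0 then k p.2 else 0 : ℤ) : ℝ)| ≤ 1} with hPk
  set C : ℝ := ∑ p : Plaquette 4 S, |u p| with hC
  set Bw : ℝ := Real.exp (|β| * Fintype.card (Plaquette 4 S)) with hBw
  have hC0 : 0 ≤ C := Finset.sum_nonneg fun p _ => abs_nonneg _
  -- the two nonnegative bounded functions `(f̃ + C) w̃` and `C w̃`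
  set ftil : EuclideanSpace ℝ (Plaquette 4 S) → ℝ := fun z => ∑ p : Plaquette 4 S, u p * Real.sin (z p) with hftil
  set wtil : EuclideanSpace ℝ (Plaquette 4 S) → ℝ := fun z =>
    Real.exp (β * ∑ q : Plaquette 4 S, Real.cos (z q)) with hwtil
  have hcoord : ∀ p : Plaquette 4 S, Continuous fun z : EuclideanSpace ℝ (Plaquette 4 S) => z p := fun p =>
    (EuclideanSpace.proj p : EuclideanSpace ℝ (Plaquette 4 S) →L[ℝ] ℝ).continuous
  have hfc : Continuous ftil := continuous_finsetSum _ fun p _ =>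
    continuous_const.mul (Real.continuous_sin.comp (hcoord p))
  have hwc : Continuous wtil := Real.continuous_exp.comp (continuous_const.mul
    (continuous_finsetSum _ fun q _ => Real.continuous_cos.comp (hcoord q)))
  have hfb : ∀ z, |ftil z| ≤ C := fun z => abs_sum_mul_sin_le u z
  have hwb : ∀ z, wtil z ≤ Bw := fun z => exp_mul_sum_cos_le β z
  have hw0 : ∀ z, 0 < wtil z := fun z => Real.exp_pos _
  have g1_nn : ∀ z, 0 ≤ (ftil z + C) * wtil z := fun z =>
    mul_nonneg (by linarith [(abs_le.1 (hfb z)).1]) (hw0 z).le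
  have g1_le : ∀ z, (ftil z + C) * wtil z ≤ 2 * C * Bw := fun z => by
    have := (abs_le.1 (hfb z)).2
    calc (ftil z + C) * wtil z ≤ (2 * C) * Bw :=
          mul_le_mul (by linarith) (hwb z) (hw0 z).le (by linarith)
      _ = 2 * C * Bw := by ring
  have g1_abs : ∀ z, |(ftil z + C) * wtil z| ≤ 2 * C * Bw := fun z => by
    rw [abs_of_nonneg (g1_nn z)]; exact g1_le z
  have g2_nn : ∀ z, 0 ≤ C * wtil z := fun z => mul_nonneg hC0 (hw0 z).le
  have g2_le : ∀ z, C * wtil z ≤ C * Bw := fun z => mul_le_mul_of_nonneg_left (hwb z) hC0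
  have g2_abs : ∀ z, |C * wtil z| ≤ C * Bw := fun z => by
    rw [abs_of_nonneg (g2_nn z)]; exact g2_le z
  have hm1 : Measurable fun z => (ftil z + C) * wtil z := ((hfc.add continuous_const).mul hwc).measurable
  have hm2 : Measurable fun z => C * wtil z := (continuous_const.mul hwc).measurable
  have h1 := sector_integral_eq hc k (g := fun z => (ftil z + C) * wtil z) hm1 (B := 2 * C * Bw) g1_nn g1_le
  have h2 := sector_integral_eq hc k (g := fun z => C * wtil z) hm2 (B := C * Bw) g2_nn g2_le
  -- upstairs: the difference is the sector integral of the transverse functional, which vanishes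
  have h0 := integral_sector_testForm_eq_zero (S := S) k β u hu0
  have hmeas : ∀ {g : EuclideanSpace ℝ (Plaquette 4 S) → ℝ}, Continuous g → (∀ z, |g z| ≤ 2 * C * Bw + C * Bw) →
      Integrable (Gk.indicator fun U : GaugeConfig 4 S Circle => g (plaqAngle U)) μH := by
    intro g hg hgb
    refine Integrable.of_bound (((hg.measurable.comp measurable_plaqAngle).indicator
      (measurableSet_sector k)).aestronglyMeasurable) (2 * C * Bw + C * Bw) (ae_of_all _ fun U => ?_)
    rw [Real.norm_eq_abs]
    by_cases hU : U ∈ Gk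
    · rw [Set.indicator_of_mem hU]; exact hgb _
    · rw [Set.indicator_of_notMem hU, abs_zero]; positivity
  have hBw0 : 0 < Bw := Real.exp_pos _
  have hCB : 0 ≤ C * Bw := mul_nonneg hC0 hBw0.le
  have hi1 : Integrable (Gk.indicator fun U : GaugeConfig 4 S Circle =>
      (ftil (plaqAngle U) + C) * wtil (plaqAngle U)) μH :=
    hmeas (g := fun z => (ftil z + C) * wtil z) ((hfc.add continuous_const).mul hwc) fun z =>
      (g1_abs z).trans (by linarith)
  have hi2 : Integrable (Gk.indicator fun U : GaugeConfig 4 S Circle => C * wtil (plaqAngle U)) μH :=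
    hmeas (g := fun z => C * wtil z) (continuous_const.mul hwc) fun z =>
      (g2_abs z).trans (by nlinarith [hC0, hBw0.le])
  have hup : (∫ U, Gk.indicator (fun U => (ftil (plaqAngle U) + C) * wtil (plaqAngle U)) U ∂μH) -
      (∫ U, Gk.indicator (fun U => C * wtil (plaqAngle U)) U ∂μH) = 0 := by
    have h0' : (∫ U, Gk.indicator (fun U => ftil (plaqAngle U) * wtil (plaqAngle U)) U ∂μH) = 0 := h0
    rw [← integral_sub hi1 hi2, ← h0']
    refine integral_congr_ae (ae_of_all _ fun U => ?_)
    by_cases hU : U ∈ Gk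
    · simp only [Set.indicator_of_mem hU]
      ring
    · simp only [Set.indicator_of_notMem hU, sub_zero]
  -- downstairs
  have hvol := volume_sectorBox_lt_top (S := S) (fun p => 2 * Real.pi *
    ((if p.1 p.2.1.1 = 0 ∧ p.1 p.2.1.2 = 0 then k p.2 else 0 : ℤ) : ℝ))
  have hPm : MeasurableSet Pk := measurableSet_sectorBox _
  have hj : ∀ {g : EuclideanSpace ℝ (Plaquette 4 S) → ℝ}, Continuous g → ∀ {B : ℝ}, (∀ z, |g z| ≤ B) →
      IntegrableOn (fun v : LinearMap.range (plaqCoboundary S) => g ((v : EuclideanSpace ℝ (Plaquette 4 S)) + cv))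
        Pk volume := by
    intro g hg B hgb
    exact Measure.integrableOn_of_bounded (M := B) hvol.ne
      ((hg.comp (continuous_subtype_val.add continuous_const)).measurable.aestronglyMeasurable)
      (ae_of_all _ fun v => by rw [Real.norm_eq_abs]; exact hgb _)
  have hj1 := hj (g := fun z => (ftil z + C) * wtil z) ((hfc.add continuous_const).mul hwc)
    (B := 2 * C * Bw) g1_abs
  have hj2 := hj (g := fun z => C * wtil z) (continuous_const.mul hwc) (B := C * Bw) g2_abs
  have hdown : (∫ v in Pk, (ftil ((v : EuclideanSpace ℝ (Plaquette 4 S)) + cv) + C) *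
        wtil ((v : EuclideanSpace ℝ (Plaquette 4 S)) + cv)) -
      (∫ v in Pk, C * wtil ((v : EuclideanSpace ℝ (Plaquette 4 S)) + cv)) =
      ∫ v in Pk, ftil ((v : EuclideanSpace ℝ (Plaquette 4 S)) + cv) *
        wtil ((v : EuclideanSpace ℝ (Plaquette 4 S)) + cv) := by
    rw [← integral_sub hj1 hj2]
    refine integral_congr_ae (ae_of_all _ fun v => ?_)
    ring
  have hcR : c.toReal ≠ 0 := ENNReal.toReal_ne_zero.2 ⟨hc0, hct⟩
  have key : c.toReal * (∫ v in Pk, ftil ((v : EuclideanSpace ℝ (Plaquette 4 S)) + cv) *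
      wtil ((v : EuclideanSpace ℝ (Plaquette 4 S)) + cv)) = 0 := by
    rw [← hdown, mul_sub, ← h1, ← h2]
    exact hup
  have := (mul_eq_zero.1 key).resolve_left hcR
  simpa [hftil, hwtil] using this

end Summit.QuantumFields.YangMills.Theorems.TransverseWardBL

end
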